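import Mathlib

/-!
# PP(12), family B1-p: collineations of order `n − 1` — typed normal forms, kernel-checked controls,
# and the census statements (cell pub-namedobj, target M, control C−M3)
Framing: lottery ticket; floor = certified bounds/negative ranges.

A projective plane of order `n` with a collineation `σ` of prime order `p = n − 1` either has `σ` a
`(C,l)`-homology (Case A) or `σ` fixes exactly a triangle (Case B) (FAMILY-B1P.md Lemma 4, paper proof).
Case A is equivalent to an `(n+1) × (n+1)` array over `ZMod (n−1)` with diagonal holes whose row pairs
are *difference-orthogonal* (`QdmRows` below; an `(n−1, n+1; 1, 1; 1)` quasi-difference matrix); Case B to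
the data `TriangleData` below satisfying `TriangleData.Valid`. Here we

* define both normal forms as DECIDABLE predicates (the exact objects the census engines
  `code/collin/caseA.*`, `caseB.*` exhaust, before normalisation by base choices);
* kernel-check the (+) controls: the arrays extracted from `PG(2,4)` and `PG(2,8)` with a homology of order
  `3` resp. `7` satisfy `QdmRows` (`decide`), and the triangle data extracted from `PG(2,4)` with
  `diag(1, ω, ω²)` satisfies `TriangleData.Valid` (`decide`);
* TYPE the two census statements for `n = 12` (`NoHomologyArray12`, `NoTriangleData12`) — NOT proved in
  Lean: they are certified by exhaustive search on two independent implementations (designs E1: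
  `caseA.c` = `caseA.py`, 104,622,730 DFS nodes, 0 solutions; `caseB.c`, 0 solutions; farm replay j097463)
  and reproduce the `p = 11` slice of Janko–van Trung, *The full collineation group of any projective
  plane of order 12 is a {2,3}-group*, Geom. Dedicata 12 (1982) 101–110.

Nothing here is conditional; the two `def … : Prop` census statements are statements only.
-/

namespace Summit.Ventures.DiscreteObjects.PP12

/-- **Case A normal form (row condition of an `(m, k; 1,1;1)` quasi-difference matrix with diagonal
holes).** `d i j ∈ ZMod m` for `i ≠ j` (the diagonal values are ignored): for any two rows `i ≠ i'` the
differences `d i j − d i' j` over the common columns `j ∉ {i, i'}` are pairwise distinct. With `k = m + 2`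
(so that there are exactly `m` common columns) this says they exhaust `ZMod m`; geometrically
(FAMILY-B1P §2): the lines `L_i^{σ^b} = {X_i} ∪ {P_j^{σ^{d i j + b}}}` pairwise meet in exactly one point,
i.e. the data define a projective plane of order `m + 1` with a cyclic `(C,l)`-homology group of order `m`. -/
def QdmRows (m k : ℕ) (d : Fin k → Fin k → ZMod m) : Prop :=
  ∀ i i' : Fin k, i ≠ i' → ∀ j j' : Fin k, j ≠ j' → j ≠ i → j ≠ i' → j' ≠ i → j' ≠ i' →
    d i j - d i' j ≠ d i j' - d i' j'

/-- `QdmRows` is decidable (a finite conjunction of disequalities in `ZMod m`). -/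
instance (m k : ℕ) (d : Fin k → Fin k → ZMod m) : Decidable (QdmRows m k d) := by
  unfold QdmRows; infer_instance

/-- The `5 × 5` array over `ZMod 3` extracted from `PG(2,4)` with the homology `diag(1,1,ω)` of order 3
(census file `M-B1p-caseA-n4.sols.jsonl`, row 0 = column 0 = 0 re-attached; diagonal entries are dummies). -/
def pg4Array : Fin 5 → Fin 5 → ZMod 3 :=
  ![![0, 0, 0, 0, 0],
    ![0, 0, 0, 1, 2],
    ![0, 0, 0, 2, 1],
    ![0, 1, 2, 0, 0],
    ![0, 2, 1, 0, 0]]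

/-- (+) control, kernel: the `PG(2,4)` homology array is a Case-A normal form. -/
theorem pg4Array_qdmRows : QdmRows 3 5 pg4Array := by
  unfold QdmRows pg4Array; decide

/-- The `9 × 9` array over `ZMod 7` extracted from `PG(2,8)` with the homology `diag(1,1,ω)` of order 7
(census file `M-B1p-caseA-n8.sols.jsonl`, solution 1, row 0 = column 0 = 0 re-attached; diagonal
entries are dummies). -/
def pg8Array : Fin 9 → Fin 9 → ZMod 7 :=
  ![![0, 0, 0, 0, 0, 0, 0, 0, 0],
    ![0, 0, 0, 1, 2, 3, 4, 5, 6],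
    ![0, 0, 0, 3, 6, 1, 5, 4, 2],
    ![0, 1, 3, 0, 4, 0, 2, 6, 5],
    ![0, 2, 6, 4, 0, 5, 1, 3, 0],
    ![0, 3, 1, 0, 5, 0, 6, 2, 4],
    ![0, 4, 5, 2, 1, 6, 0, 0, 3],
    ![0, 5, 4, 6, 3, 2, 0, 0, 1],
    ![0, 6, 2, 5, 0, 4, 3, 1, 0]]

/-- (+) control, kernel: the `PG(2,8)` homology array is a Case-A normal form (an `(7, 9; 1,1;1)`-QDM). -/
theorem pg8Array_qdmRows : QdmRows 7 9 pg8Array := by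
  unfold QdmRows pg8Array; decide

/-- **Census statement, Case A at `n = 12` (typed only).** No `13 × 13` array over `ZMod 11` satisfies
the Case-A row condition; equivalently (FAMILY-B1P §2) no projective plane of order 12 admits a homology
of order 11 (a cyclic `(C,l)`-transitive homology group). Certified by exhaustive search on two
implementations (designs `caseA.c` = `caseA.py`: 0 solutions, 104,622,730 nodes; j097463); in print as a
case of Janko–van Trung 1982 (Geom. Dedicata 12, 101–110). NOT proved here. -/
def NoHomologyArray12 : Prop := ∀ d : Fin 13 → Fin 13 → ZMod 11, ¬ QdmRows 11 13 d

/-- **Case B data** for modulus `m` (collineation of prime order `m = n − 1` fixing exactly a triangle,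
FAMILY-B1P §3, after base choices; residues are coded as `Fin m` with its modular `+`/`−`): `phi t` =
position of the free point orbit named `t` on the base line of the third pencil; for each of the `m` free
line orbits `s`: the positions `g1 s`, `g2 s` of its side points on `S_1`, `S_2` (the `S_0` position is
normalised to `0`) and the membership table `mem s t x ↔ x ∈ E_{s,t}` of its free points. -/
structure TriangleData (m : ℕ) where
  /-- third-pencil positions (an orthomorphism-type bijection of `Z_m`) -/
  phi : Fin m → Fin m
  /-- `S_1`-position of the base line of free line orbit `s` -/
  g1 : Fin m → Fin m
  /-- `S_2`-position of the base line of free line orbit `s` -/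
  g2 : Fin m → Fin m
  /-- `mem s t x`: the base line of orbit `s` contains the point `P_t^{σ^x}` -/
  mem : Fin m → Fin m → Fin m → Bool

namespace TriangleData

variable {m : ℕ}

/-- (Φ) `phi` and `t ↦ t − phi t` are injective (lines of different pencils meet exactly once). -/
def PhiOK (D : TriangleData m) : Prop :=
  (∀ t t', D.phi t = D.phi t' → t = t') ∧ ∀ t t', t - D.phi t = t' - D.phi t' → t = t'

/-- (K) for the shift function `f` (`0`, `id` or `phi`) and the excluded value `g`: the translates
`E_{s,t} − f t` partition `Z_m ∖ {g}` (every pencil line meets the free line exactly once). -/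
def PartitionOK (D : TriangleData m) (s : Fin m) (f : Fin m → Fin m) (g : Fin m) : Prop :=
  (∀ t, D.mem s t (g + f t) = false) ∧
    ∀ y, y ≠ g → ∃ t, D.mem s t (y + f t) = true ∧ ∀ t', D.mem s t' (y + f t') = true → t' = t

/-- (D) internal differences of the family `{E_{s,t}}_t` hit every non-zero residue exactly once (two lines
of the same free orbit meet exactly once). -/
def InternalOK [NeZero m] (D : TriangleData m) (s : Fin m) : Prop :=
  ∀ δ : Fin m, δ ≠ 0 → ∃ t x, D.mem s t x = true ∧ D.mem s t (x - δ) = true ∧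
    ∀ t' x', D.mem s t' x' = true → D.mem s t' (x' - δ) = true → t' = t ∧ x' = x

/-- no free point of orbit `s` differs by `δ` (within the same point orbit) from a free point of orbit `s'` -/
def PairNone (D : TriangleData m) (s s' : Fin m) (δ : Fin m) : Prop :=
  ∀ t x, ¬ (D.mem s t x = true ∧ D.mem s' t (x - δ) = true)

/-- exactly one pair of free points of orbits `s`, `s'` (same point orbit) differs by `δ` -/
def PairOne (D : TriangleData m) (s s' : Fin m) (δ : Fin m) : Prop :=
  ∃ t x, D.mem s t x = true ∧ D.mem s' t (x - δ) = true ∧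
    ∀ t' x', D.mem s t' x' = true → D.mem s' t' (x' - δ) = true → t' = t ∧ x' = x

/-- (X) two different free line orbits `s ≠ s'`: for `δ = 0` neither side position nor any free point is
shared (the `S_0` positions already agree); for `δ ≠ 0` exactly one of "`g1` differs by `δ`", "`g2` differs
by `δ`", "a unique pair of free points differs by `δ`" holds (lines of different free orbits meet exactly once). -/
def CrossOK [NeZero m] (D : TriangleData m) (s s' : Fin m) : Prop :=
  D.g1 s ≠ D.g1 s' ∧ D.g2 s ≠ D.g2 s' ∧ D.PairNone s s' 0 ∧
  ∀ δ : Fin m, δ ≠ 0 →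
    (D.g1 s - D.g1 s' = δ ∧ D.g2 s - D.g2 s' ≠ δ ∧ D.PairNone s s' δ) ∨
    (D.g1 s - D.g1 s' ≠ δ ∧ D.g2 s - D.g2 s' = δ ∧ D.PairNone s s' δ) ∨
    (D.g1 s - D.g1 s' ≠ δ ∧ D.g2 s - D.g2 s' ≠ δ ∧ D.PairOne s s' δ)

/-- **Case B normal form**: all conditions of FAMILY-B1P §3. -/
def Valid [NeZero m] (D : TriangleData m) : Prop :=
  D.PhiOK ∧ (∀ s, D.PartitionOK s (fun _ => 0) 0 ∧ D.PartitionOK s id (D.g1 s) ∧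
    D.PartitionOK s D.phi (D.g2 s) ∧ D.InternalOK s) ∧ ∀ s s', s ≠ s' → D.CrossOK s s'

/-- (K) is decidable. -/
instance (D : TriangleData m) (s : Fin m) (f : Fin m → Fin m) (g : Fin m) :
    Decidable (D.PartitionOK s f g) := by unfold PartitionOK; infer_instance
/-- (D) is decidable. -/
instance [NeZero m] (D : TriangleData m) (s : Fin m) : Decidable (D.InternalOK s) := by
  unfold InternalOK; infer_instance
/-- `PairNone` is decidable. -/
instance (D : TriangleData m) (s s' δ : Fin m) : Decidable (D.PairNone s s' δ) := by
  unfold PairNone; infer_instance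
/-- `PairOne` is decidable. -/
instance (D : TriangleData m) (s s' δ : Fin m) : Decidable (D.PairOne s s' δ) := by
  unfold PairOne; infer_instance
/-- (X) is decidable. -/
instance [NeZero m] (D : TriangleData m) (s s' : Fin m) : Decidable (D.CrossOK s s') := by
  unfold CrossOK; infer_instance
/-- (Φ) is decidable. -/
instance (D : TriangleData m) : Decidable D.PhiOK := by unfold PhiOK; infer_instance
/-- `Valid` is decidable, so explicit data are checked by `decide`. -/
instance [NeZero m] (D : TriangleData m) : Decidable D.Valid := by unfold Valid; infer_instance

end TriangleData

/-- The Case-B data extracted from `PG(2,4)` with the collineation `diag(1, ω, ω²)` of order 3 fixing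
exactly the coordinate triangle (census file `M-B1p-caseB-n4.sols.jsonl`: `phi = (0,2,1)`; rows
`(g1,g2,E) = (0,0,{E_0 = {1,2}}), (2,1,{E_1 = {1,2}}), (1,2,{E_2 = {1,2}})`). -/
def pg4Triangle : TriangleData 3 where
  phi := ![0, 2, 1]
  g1 := ![0, 2, 1]
  g2 := ![0, 1, 2]
  mem := fun s t x => decide (t = s) && decide (x ≠ 0)

/-- (+) control, kernel: the `PG(2,4)` triangle data are a valid Case-B normal form. -/
theorem pg4Triangle_valid : pg4Triangle.Valid := by
  decide

/-- **Census statement, Case B at `n = 12` (typed only).** No Case-B data over `Z_11` are valid;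
equivalently (FAMILY-B1P §3) no projective plane of order 12 admits a collineation of order 11 fixing
exactly a triangle. Certified by exhaustive search (designs `caseB.c`: 3,441 `phi`, 207,020 K1-labelled
starter partitions, 476,784 candidate rows, 660 compatible pairs, no 11-clique; `caseB.py` twin in
j097463); in print as a case of Janko–van Trung 1982. NOT proved here. -/
def NoTriangleData12 : Prop := ∀ D : TriangleData 11, ¬ D.Valid

/-- **The reproduced slice, as one typed statement**: both normal forms are empty at `n = 12`, i.e.
(FAMILY-B1P Lemma 4 + §2 + §3) a projective plane of order 12 has no collineation of order 11. -/
def NoCollineationOfOrderEleven : Prop := NoHomologyArray12 ∧ NoTriangleData12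

end Summit.Ventures.DiscreteObjects.PP12
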